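import Mathlib

/-!
# Stub `cauchyKernel_jump` of line `Sketch` for crux `WeilComb.CombShapePositivity`
(item stmt-RiemannHypothesis-11229, STUB-PLAN-stub_fejer, tier T2 "dilation detection", component T2l)

The **Sokhotski–Plemelj jump** of the Cauchy–Laplace kernel
`K_f(w, s) = ∫_{-2}^{2} f(t) e^{wt - s} / (s - wt) dt` across its segment `w · [-2, 2]` at an interior
point `s₀ = w t₀`, `t₀ ∈ (-2, 2)`, approached along the unit normal `n = i w / ‖w‖`:
`K_f(w, s₀ + η n) - K_f(w, s₀ - η n) → -(2πi / w) f(t₀)` as `η → 0⁺`, for `f` continuous and `w ≠ 0`.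

**Proof.** Put `δ = η / ‖w‖`, so `s₀ ± η n = w (t₀ ± iδ)`.  After the substitution `t = t₀ + δ u`
the difference of the two integrands, multiplied by `dt/du = δ`, becomes
`E_δ(u) = f(t₀ + δu) e^{wδ(u - i)} [ (1/(i-u) + 1/(i+u))/w + (e^{2iwδ} - 1)/(w(i+u)) ]`
on the `u`-interval `((-2 - t₀)/δ, (2 - t₀)/δ]`, which exhausts `ℝ` as `δ → 0⁺`.  Pointwise
`E_δ(u) → f(t₀) (1/(i-u) + 1/(i+u))/w = -(2i/w) f(t₀) /(1 + u²)` (a Poisson kernel), and on the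
`u`-interval (where `δ|u| ≤ 4`) one has the domination `‖E_δ(u)‖ ≤ C /(1 + u²)` for `δ ≤ 1`,
`2‖w‖δ ≤ 1` (using `‖e^{z} - 1‖ ≤ 2‖z‖` for `‖z‖ ≤ 1` and `‖i + u‖² = 1 + u²`).  Dominated convergence
and `∫ du/(1+u²) = π` give the limit `-(2πi/w) f(t₀)`.  Mathlib only; this is the T2l component
(jump of one kernel across its segment) of the dilation-detection tier T2 of STUB-PLAN-stub_fejer.
-/

noncomputable section

-- the sub-problem path RiemannHypothesis/RiemannHypothesis duplicates a namespace (D-0017)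
set_option linter.dupNamespace false

open scoped Real Topology
open Complex MeasureTheory Set Filter

namespace Summit.RiemannHypothesis.RiemannHypothesis.Theorems.WeilCombBohrFejer

/-- `i - u ≠ 0` for real `u`. [folklore] -/
private theorem I_sub_ne_zero (u : ℝ) : I - (u : ℂ) ≠ 0 := fun h => by
  simpa using congrArg Complex.im h

/-- `i + u ≠ 0` for real `u`. [folklore] -/
private theorem I_add_ne_zero (u : ℝ) : I + (u : ℂ) ≠ 0 := fun h => by
  simpa using congrArg Complex.im h

/-- `‖i + u‖² = 1 + u²` for real `u`. [folklore] -/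
private theorem norm_I_add_sq (u : ℝ) : ‖I + (u : ℂ)‖ ^ 2 = 1 + u ^ 2 := by
  rw [Complex.sq_norm, Complex.normSq_apply]
  simp
  ring

/-- The Poisson-kernel identity `1/(i-u) + 1/(i+u) = -2i/(1+u²)` for real `u`. [folklore] -/
private theorem inv_add_inv_eq (u : ℝ) :
    1 / (I - (u : ℂ)) + 1 / (I + (u : ℂ)) = -(2 * I) * (((1 + u ^ 2)⁻¹ : ℝ) : ℂ) := by
  have hprod : (I - (u : ℂ)) * (I + (u : ℂ)) = -(((1 + u ^ 2 : ℝ)) : ℂ) := by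
    push_cast
    linear_combination Complex.I_sq
  rw [div_add_div _ _ (I_sub_ne_zero u) (I_add_ne_zero u), hprod]
  have h3 : ((1 + u ^ 2 : ℝ) : ℂ) ≠ 0 := by
    exact_mod_cast (by positivity : (1 + u ^ 2 : ℝ) ≠ 0)
  push_cast at h3 ⊢
  field_simp
  ring

/-- On the rescaled range (`δ |u| ≤ 4`) and for `δ ≤ 1`: `‖e^{wδ(u-i)}‖ ≤ e^{5‖w‖}`. [folklore] -/
private theorem norm_exp_factor_le (w : ℂ) {δ u : ℝ} (hδ : 0 < δ) (hδ1 : δ ≤ 1)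
    (hδu : δ * |u| ≤ 4) : ‖cexp (w * δ * (u - I))‖ ≤ Real.exp (5 * ‖w‖) := by
  rw [Complex.norm_exp]
  refine Real.exp_le_exp.mpr ?_
  calc (w * δ * (u - I)).re ≤ ‖w * δ * (u - I)‖ := re_le_norm _
    _ = ‖w‖ * δ * ‖(u : ℂ) - I‖ := by
        rw [norm_mul, norm_mul, Complex.norm_real, Real.norm_eq_abs, abs_of_pos hδ]
    _ ≤ ‖w‖ * δ * (|u| + 1) := by
        gcongr
        calc ‖(u : ℂ) - I‖ ≤ ‖(u : ℂ)‖ + ‖I‖ := norm_sub_le _ _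
          _ = |u| + 1 := by rw [Complex.norm_real, Real.norm_eq_abs, Complex.norm_I]
    _ = ‖w‖ * (δ * |u| + δ) := by ring
    _ ≤ ‖w‖ * (4 + 1) := by gcongr
    _ = 5 * ‖w‖ := by ring

/-- Domination of the bracket: for `0 < δ ≤ 1`, `2‖w‖δ ≤ 1` and `δ|u| ≤ 4`,
`‖(1/(i-u) + 1/(i+u))/w + (e^{2iwδ} - 1)/(w(i+u))‖ ≤ (2/‖w‖ + 20)/(1+u²)`. [folklore] -/
private theorem norm_bracket_le {w : ℂ} (hw : w ≠ 0) {δ u : ℝ} (hδ : 0 < δ) (hδ1 : δ ≤ 1)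
    (hδw : 2 * ‖w‖ * δ ≤ 1) (hδu : δ * |u| ≤ 4) :
    ‖(1 / (I - (u : ℂ)) + 1 / (I + (u : ℂ))) / w +
        (cexp (2 * I * w * δ) - 1) / (w * (I + (u : ℂ)))‖ ≤ (2 / ‖w‖ + 20) * (1 + u ^ 2)⁻¹ := by
  have hw' : 0 < ‖w‖ := norm_pos_iff.mpr hw
  have hwne : ‖w‖ ≠ 0 := hw'.ne'
  have hr : 0 < (1 + u ^ 2)⁻¹ := by positivity
  have hIu : 0 < ‖I + (u : ℂ)‖ := norm_pos_iff.mpr (I_add_ne_zero u)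
  have hIune : ‖I + (u : ℂ)‖ ≠ 0 := hIu.ne'
  -- the Poisson part
  have h1 : ‖(1 / (I - (u : ℂ)) + 1 / (I + (u : ℂ))) / w‖ = 2 / ‖w‖ * (1 + u ^ 2)⁻¹ := by
    rw [inv_add_inv_eq, norm_div, norm_mul, norm_neg, norm_mul, Complex.norm_real,
      Real.norm_eq_abs, abs_of_pos hr, Complex.norm_two, Complex.norm_I]
    ring
  -- the remainder
  have hQ : ‖cexp (2 * I * w * δ) - 1‖ ≤ 4 * ‖w‖ * δ := by
    have hz : ‖2 * I * w * (δ : ℂ)‖ = 2 * ‖w‖ * δ := by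
      rw [norm_mul, norm_mul, norm_mul, Complex.norm_real, Real.norm_eq_abs, abs_of_pos hδ,
        Complex.norm_two, Complex.norm_I]
      ring
    have h := Complex.norm_exp_sub_one_le (x := 2 * I * w * δ) (by rw [hz]; exact hδw)
    rw [hz] at h
    linarith
  have hIu' : ‖I + (u : ℂ)‖ ≤ 1 + |u| := by
    calc ‖I + (u : ℂ)‖ ≤ ‖I‖ + ‖(u : ℂ)‖ := norm_add_le _ _
      _ = 1 + |u| := by rw [Complex.norm_real, Real.norm_eq_abs, Complex.norm_I]
  have hkey : ‖cexp (2 * I * w * δ) - 1‖ * ‖I + (u : ℂ)‖ ≤ 20 * ‖w‖ := by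
    calc ‖cexp (2 * I * w * δ) - 1‖ * ‖I + (u : ℂ)‖ ≤ (4 * ‖w‖ * δ) * (1 + |u|) :=
          mul_le_mul hQ hIu' (norm_nonneg _) (by positivity)
      _ = 4 * ‖w‖ * (δ + δ * |u|) := by ring
      _ ≤ 4 * ‖w‖ * (1 + 4) := by gcongr
      _ = 20 * ‖w‖ := by ring
  have h2 : ‖(cexp (2 * I * w * δ) - 1) / (w * (I + (u : ℂ)))‖ ≤ 20 * (1 + u ^ 2)⁻¹ := by
    rw [norm_div, norm_mul, ← norm_I_add_sq, div_le_iff₀ (by positivity)]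
    calc ‖cexp (2 * I * w * δ) - 1‖
        = ‖cexp (2 * I * w * δ) - 1‖ * ‖I + (u : ℂ)‖ / ‖I + (u : ℂ)‖ := by field_simp
      _ ≤ 20 * ‖w‖ / ‖I + (u : ℂ)‖ := by gcongr
      _ = 20 * (‖I + (u : ℂ)‖ ^ 2)⁻¹ * (‖w‖ * ‖I + (u : ℂ)‖) := by field_simp
  calc _ ≤ ‖(1 / (I - (u : ℂ)) + 1 / (I + (u : ℂ))) / w‖ +
        ‖(cexp (2 * I * w * δ) - 1) / (w * (I + (u : ℂ)))‖ := norm_add_le _ _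
    _ ≤ 2 / ‖w‖ * (1 + u ^ 2)⁻¹ + 20 * (1 + u ^ 2)⁻¹ := by rw [h1]; gcongr
    _ = (2 / ‖w‖ + 20) * (1 + u ^ 2)⁻¹ := by ring

/-- Domination of the rescaled integrand `E_δ(u)` on the rescaled interval: `‖E_δ(u)‖ ≤ C/(1+u²)`
with `C = M e^{5‖w‖} (2/‖w‖ + 20)`, `M` a bound for `‖f‖` on `[-2, 2]`. [folklore] -/
private theorem norm_integrand_le {f : ℝ → ℂ} {M : ℝ} (hM : ∀ t ∈ Icc (-2 : ℝ) 2, ‖f t‖ ≤ M)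
    {w : ℂ} (hw : w ≠ 0) {t₀ : ℝ} (ht₀ : t₀ ∈ Ioo (-2 : ℝ) 2) {δ : ℝ} (hδ : 0 < δ) (hδ1 : δ ≤ 1)
    (hδw : 2 * ‖w‖ * δ ≤ 1) {u : ℝ} (hu : u ∈ Ioc ((-2 - t₀) / δ) ((2 - t₀) / δ)) :
    ‖f (δ * u + t₀) * cexp (w * δ * (u - I)) *
        ((1 / (I - (u : ℂ)) + 1 / (I + (u : ℂ))) / w +
          (cexp (2 * I * w * δ) - 1) / (w * (I + (u : ℂ))))‖ ≤
      M * Real.exp (5 * ‖w‖) * (2 / ‖w‖ + 20) * (1 + u ^ 2)⁻¹ := by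
  have hu1 : -2 - t₀ < δ * u := by
    have h := hu.1
    rwa [div_lt_iff₀ hδ, mul_comm] at h
  have hu2 : δ * u ≤ 2 - t₀ := by
    have h := hu.2
    rwa [le_div_iff₀ hδ, mul_comm] at h
  have ht : δ * u + t₀ ∈ Icc (-2 : ℝ) 2 := ⟨by linarith, by linarith⟩
  have hδu : δ * |u| ≤ 4 := by
    rw [← abs_of_pos hδ, ← abs_mul]
    exact abs_le.mpr ⟨by linarith [ht₀.2], by linarith [ht₀.1]⟩
  have hM0 : 0 ≤ M := (norm_nonneg _).trans (hM _ ht)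
  rw [norm_mul, norm_mul]
  calc ‖f (δ * u + t₀)‖ * ‖cexp (w * δ * (u - I))‖ *
        ‖(1 / (I - (u : ℂ)) + 1 / (I + (u : ℂ))) / w +
          (cexp (2 * I * w * δ) - 1) / (w * (I + (u : ℂ)))‖ ≤
      M * Real.exp (5 * ‖w‖) * ((2 / ‖w‖ + 20) * (1 + u ^ 2)⁻¹) :=
        mul_le_mul (mul_le_mul (hM _ ht) (norm_exp_factor_le w hδ hδ1 hδu) (norm_nonneg _) hM0)
          (norm_bracket_le hw hδ hδ1 hδw hδu) (norm_nonneg _)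
          (mul_nonneg hM0 (Real.exp_pos _).le)
    _ = _ := by ring

/-- **Rescaled form of the jump.** With `E_δ` as in the module docstring,
`∫ 1_{((-2-t₀)/δ, (2-t₀)/δ]}(u) E_δ(u) du → -(2πi/w) f(t₀)` as `δ → 0⁺` (dominated convergence against
`C/(1+u²)`, pointwise limit `-(2i/w) f(t₀)/(1+u²)`, `∫ du/(1+u²) = π`). [folklore] -/
private theorem jump_core {f : ℝ → ℂ} (hf : Continuous f) {w : ℂ} (hw : w ≠ 0) {t₀ : ℝ}
    (ht₀ : t₀ ∈ Ioo (-2 : ℝ) 2) :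
    Tendsto (fun δ : ℝ => ∫ u : ℝ, (Ioc ((-2 - t₀) / δ) ((2 - t₀) / δ)).indicator
      (fun u : ℝ => f (δ * u + t₀) * cexp (w * δ * (u - I)) *
        ((1 / (I - (u : ℂ)) + 1 / (I + (u : ℂ))) / w +
          (cexp (2 * I * w * δ) - 1) / (w * (I + (u : ℂ))))) u)
      (𝓝[>] 0) (𝓝 (-(2 * π * I / w) * f t₀)) := by
  set E : ℝ → ℝ → ℂ := fun δ u => f (δ * u + t₀) * cexp (w * δ * (u - I)) *
        ((1 / (I - (u : ℂ)) + 1 / (I + (u : ℂ))) / w +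
          (cexp (2 * I * w * δ) - 1) / (w * (I + (u : ℂ)))) with hE
  show Tendsto (fun δ : ℝ => ∫ u : ℝ, (Ioc ((-2 - t₀) / δ) ((2 - t₀) / δ)).indicator (E δ) u) _ _
  obtain ⟨M, hM⟩ := (isCompact_Icc (a := (-2 : ℝ)) (b := 2)).exists_bound_of_continuousOn
    hf.continuousOn
  have hM0 : 0 ≤ M := (norm_nonneg _).trans (hM 0 (by norm_num))
  -- continuity of `E` in each variable
  have hEu : ∀ δ : ℝ, Continuous (E δ) := fun δ => by
    have c1 : Continuous fun u : ℝ => 1 / (I - (u : ℂ)) :=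
      continuous_const.div (by fun_prop) I_sub_ne_zero
    have c2 : Continuous fun u : ℝ => 1 / (I + (u : ℂ)) :=
      continuous_const.div (by fun_prop) I_add_ne_zero
    have c3 : Continuous fun u : ℝ => (cexp (2 * I * w * δ) - 1) / (w * (I + (u : ℂ))) :=
      continuous_const.div (by fun_prop) fun u => mul_ne_zero hw (I_add_ne_zero u)
    have c4 : Continuous fun u : ℝ => f (δ * u + t₀) * cexp (w * δ * (u - I)) := by fun_prop
    exact c4.mul (((c1.add c2).div_const w).add c3)
  have hEδ : ∀ u : ℝ, Continuous (fun δ : ℝ => E δ u) := fun u => by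
    have c3 : Continuous fun δ : ℝ => (cexp (2 * I * w * δ) - 1) / (w * (I + (u : ℂ))) :=
      (Continuous.sub (by fun_prop) continuous_const).div_const _
    have c4 : Continuous fun δ : ℝ => f (δ * u + t₀) * cexp (w * δ * (u - I)) := by fun_prop
    exact c4.mul (continuous_const.add c3)
  -- the pointwise limit
  have hlim : ∀ u : ℝ, E 0 u = (-(2 * I / w) * f t₀) * (((1 + u ^ 2)⁻¹ : ℝ) : ℂ) := fun u => by
    simp only [hE, zero_mul, zero_add, Complex.ofReal_zero, mul_zero, Complex.exp_zero, mul_one,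
      sub_self, zero_div, add_zero]
    rw [inv_add_inv_eq]
    ring
  have hL : -(2 * π * I / w) * f t₀ = ∫ u : ℝ, (-(2 * I / w) * f t₀) * (((1 + u ^ 2)⁻¹ : ℝ) : ℂ) := by
    rw [integral_const_mul, integral_complex_ofReal, integral_univ_inv_one_add_sq]
    ring
  rw [hL]
  -- eventual smallness of `δ`
  have hev : ∀ᶠ δ in 𝓝[>] (0 : ℝ), 0 < δ ∧ δ ≤ 1 ∧ 2 * ‖w‖ * δ ≤ 1 := by
    have h1 : ∀ᶠ δ in 𝓝 (0 : ℝ), δ ≤ 1 := eventually_le_nhds one_pos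
    have h2 : ∀ᶠ δ in 𝓝 (0 : ℝ), 2 * ‖w‖ * δ ≤ 1 := by
      have h : Tendsto (fun δ : ℝ => 2 * ‖w‖ * δ) (𝓝 0) (𝓝 (2 * ‖w‖ * 0)) :=
        tendsto_const_nhds.mul tendsto_id
      rw [mul_zero] at h
      exact h.eventually (eventually_le_nhds one_pos)
    filter_upwards [eventually_mem_nhdsWithin, h1.filter_mono nhdsWithin_le_nhds,
      h2.filter_mono nhdsWithin_le_nhds] with δ hδ hδ1 hδ2
    exact ⟨hδ, hδ1, hδ2⟩
  refine tendsto_integral_filter_of_dominated_convergence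
    (fun u => M * Real.exp (5 * ‖w‖) * (2 / ‖w‖ + 20) * (1 + u ^ 2)⁻¹) ?_ ?_ ?_ ?_
  · exact Eventually.of_forall fun δ => (hEu δ).aestronglyMeasurable.indicator measurableSet_Ioc
  · filter_upwards [hev] with δ hδ
    refine Eventually.of_forall fun u => ?_
    by_cases hu : u ∈ Ioc ((-2 - t₀) / δ) ((2 - t₀) / δ)
    · rw [indicator_of_mem hu]
      exact norm_integrand_le hM hw ht₀ hδ.1 hδ.2.1 hδ.2.2 hu
    · rw [indicator_of_notMem hu, norm_zero]
      positivity
  · exact integrable_inv_one_add_sq.const_mul _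
  · refine Eventually.of_forall fun u => ?_
    have hmem : ∀ᶠ δ in 𝓝[>] (0 : ℝ), u ∈ Ioc ((-2 - t₀) / δ) ((2 - t₀) / δ) := by
      have ht : Tendsto (fun δ : ℝ => δ * u) (𝓝 0) (𝓝 (0 * u)) := tendsto_id.mul tendsto_const_nhds
      rw [zero_mul] at ht
      have hI : Ioo (-2 - t₀) (2 - t₀) ∈ 𝓝 (0 : ℝ) :=
        Ioo_mem_nhds (by linarith [ht₀.1]) (by linarith [ht₀.2])
      filter_upwards [eventually_mem_nhdsWithin,
        (ht.eventually_mem hI).filter_mono nhdsWithin_le_nhds] with δ hδ h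
      exact ⟨(div_lt_iff₀ hδ).mpr (by rw [mul_comm]; exact h.1),
        (le_div_iff₀ hδ).mpr (by rw [mul_comm]; exact h.2.le)⟩
    have h1 : Tendsto (fun δ => E δ u) (𝓝[>] 0) (𝓝 (E 0 u)) :=
      ((hEδ u).tendsto 0).mono_left nhdsWithin_le_nhds
    rw [hlim u] at h1
    refine h1.congr' ?_
    filter_upwards [hmem] with δ hδ
    exact (indicator_of_mem hδ _).symm

/-- **Change of variables.** For `η > 0` and `δ = η/‖w‖`, the difference of the two kernel integrals
at `s₀ ± η n` equals `∫ 1_{((-2-t₀)/δ, (2-t₀)/δ]}(u) E_δ(u) du` (substitution `t = δu + t₀`; the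
integrands are continuous since the denominators `w(t₀ - t ± iδ)` do not vanish). [folklore] -/
private theorem jump_subst {f : ℝ → ℂ} (hf : Continuous f) {w : ℂ} (hw : w ≠ 0) (t₀ : ℝ) {η : ℝ}
    (hη : 0 < η) :
    ((∫ t in (-2 : ℝ)..2, f t * cexp (w * t - (w * t₀ + η * (I * w / (‖w‖ : ℂ)))) /
          (w * t₀ + η * (I * w / (‖w‖ : ℂ)) - w * t)) -
        ∫ t in (-2 : ℝ)..2, f t * cexp (w * t - (w * t₀ - η * (I * w / (‖w‖ : ℂ)))) /
          (w * t₀ - η * (I * w / (‖w‖ : ℂ)) - w * t)) =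
      ∫ u : ℝ, (Ioc ((-2 - t₀) / (η / ‖w‖)) ((2 - t₀) / (η / ‖w‖))).indicator
        (fun u : ℝ => f (η / ‖w‖ * u + t₀) * cexp (w * (η / ‖w‖ : ℝ) * (u - I)) *
          ((1 / (I - (u : ℂ)) + 1 / (I + (u : ℂ))) / w +
            (cexp (2 * I * w * (η / ‖w‖ : ℝ)) - 1) / (w * (I + (u : ℂ))))) u := by
  set δ : ℝ := η / ‖w‖ with hδ_def
  have hw' : 0 < ‖w‖ := norm_pos_iff.mpr hw
  have hδ : 0 < δ := div_pos hη hw'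
  have hδc : (δ : ℂ) ≠ 0 := by exact_mod_cast hδ.ne'
  have hwc : (‖w‖ : ℂ) ≠ 0 := by exact_mod_cast hw'.ne'
  have hηδ : (η : ℂ) * (I * w / (‖w‖ : ℂ)) = I * w * (δ : ℂ) := by
    rw [hδ_def]
    push_cast
    field_simp
  rw [hηδ]
  -- the two integrands are continuous on `ℝ`
  have hne1 : ∀ t : ℝ, w * t₀ + I * w * δ - w * t ≠ 0 := fun t h => by
    have h' : w * ((t₀ - t : ℝ) + δ * I) = 0 := by rw [← h]; push_cast; ring
    rcases mul_eq_zero.mp h' with h1 | h1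
    · exact hw h1
    · exact hδ.ne' (by simpa using congrArg Complex.im h1)
  have hne2 : ∀ t : ℝ, w * t₀ - I * w * δ - w * t ≠ 0 := fun t h => by
    have h' : w * ((t₀ - t : ℝ) - δ * I) = 0 := by rw [← h]; push_cast; ring
    rcases mul_eq_zero.mp h' with h1 | h1
    · exact hw h1
    · exact hδ.ne' (by simpa using congrArg Complex.im h1)
  have hc1 : Continuous fun t : ℝ =>
      f t * cexp (w * t - (w * t₀ + I * w * δ)) / (w * t₀ + I * w * δ - w * t) :=
    (by fun_prop : Continuous fun t : ℝ => f t * cexp (w * t - (w * t₀ + I * w * δ))).div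
      (by fun_prop) hne1
  have hc2 : Continuous fun t : ℝ =>
      f t * cexp (w * t - (w * t₀ - I * w * δ)) / (w * t₀ - I * w * δ - w * t) :=
    (by fun_prop : Continuous fun t : ℝ => f t * cexp (w * t - (w * t₀ - I * w * δ))).div
      (by fun_prop) hne2
  rw [← intervalIntegral.integral_sub (hc1.intervalIntegrable (-2) 2) (hc2.intervalIntegrable (-2) 2)]
  set D : ℝ → ℂ := fun t : ℝ =>
    f t * cexp (w * t - (w * t₀ + I * w * δ)) / (w * t₀ + I * w * δ - w * t) -
      f t * cexp (w * t - (w * t₀ - I * w * δ)) / (w * t₀ - I * w * δ - w * t) with hD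
  have hab : (-2 - t₀) / δ ≤ (2 - t₀) / δ := div_le_div_of_nonneg_right (by linarith) hδ.le
  rw [integral_indicator measurableSet_Ioc, ← intervalIntegral.integral_of_le hab]
  have hend1 : δ * ((-2 - t₀) / δ) + t₀ = -2 := by field_simp; ring
  have hend2 : δ * ((2 - t₀) / δ) + t₀ = 2 := by field_simp; ring
  have hsub := intervalIntegral.smul_integral_comp_mul_add D δ t₀ (a := (-2 - t₀) / δ)
    (b := (2 - t₀) / δ)
  rw [hend1, hend2] at hsub
  rw [← hsub, ← intervalIntegral.integral_smul]
  refine intervalIntegral.integral_congr fun u _ => ?_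
  have h1 := I_sub_ne_zero u
  have h2 := I_add_ne_zero u
  simp only [hD, Complex.real_smul]
  have e1 : cexp (w * ((δ * u + t₀ : ℝ) : ℂ) - (w * t₀ + I * w * δ)) = cexp (w * δ * (u - I)) := by
    congr 1
    push_cast
    ring
  have e2 : cexp (w * ((δ * u + t₀ : ℝ) : ℂ) - (w * t₀ - I * w * δ)) =
      cexp (w * δ * (u - I)) * cexp (2 * I * w * δ) := by
    rw [← Complex.exp_add]
    congr 1
    push_cast
    ring
  have d1 : w * t₀ + I * w * δ - w * ((δ * u + t₀ : ℝ) : ℂ) = w * δ * (I - u) := by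
    push_cast
    ring
  have d2 : w * t₀ - I * w * δ - w * ((δ * u + t₀ : ℝ) : ℂ) = -(w * δ * (I + u)) := by
    push_cast
    ring
  rw [e1, e2, d1, d2]
  field_simp
  ring

/-- **Sokhotski–Plemelj jump for the Cauchy–Laplace kernel** (stub `cauchyKernel_jump`, T2l).
For `f` continuous, `w ≠ 0` and `t₀ ∈ (-2, 2)`, with `n = i w/‖w‖` the unit normal to the segment
`w · [-2, 2]` at `s₀ = w t₀`,
`∫_{-2}^{2} f(t) e^{wt - s⁺}/(s⁺ - wt) dt - ∫_{-2}^{2} f(t) e^{wt - s⁻}/(s⁻ - wt) dt → -(2πi/w) f(t₀)`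
as `η → 0⁺`, where `s± = s₀ ± η n`. [folklore] -/
theorem cauchyKernel_jump : ∀ f : ℝ → ℂ, Continuous f → ∀ w : ℂ, w ≠ 0 → ∀ t₀ : ℝ, t₀ ∈ Set.Ioo (-2 : ℝ) 2 → Filter.Tendsto (fun η : ℝ => (∫ t in (-2 : ℝ)..2, f t * Complex.exp (w * t - (w * t₀ + η * (I * w / (‖w‖ : ℂ)))) / (w * t₀ + η * (I * w / (‖w‖ : ℂ)) - w * t)) - ∫ t in (-2 : ℝ)..2, f t * Complex.exp (w * t - (w * t₀ - η * (I * w / (‖w‖ : ℂ)))) / (w * t₀ - η * (I * w / (‖w‖ : ℂ)) - w * t)) (nhdsWithin 0 (Set.Ioi 0)) (nhds (-(2 * Real.pi * I / w) * f t₀)) := by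
  intro f hf w hw t₀ ht₀
  have hw' : 0 < ‖w‖ := norm_pos_iff.mpr hw
  have hδ : Tendsto (fun η : ℝ => η / ‖w‖) (𝓝[>] 0) (𝓝[>] 0) := by
    refine tendsto_nhdsWithin_iff.mpr ⟨?_, ?_⟩
    · have h : Tendsto (fun η : ℝ => η / ‖w‖) (𝓝 0) (𝓝 (0 / ‖w‖)) := tendsto_id.div_const _
      rw [zero_div] at h
      exact h.mono_left nhdsWithin_le_nhds
    · exact eventually_mem_nhdsWithin.mono fun η hη => div_pos hη hw'
  refine ((jump_core hf hw ht₀).comp hδ).congr' ?_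
  exact eventually_mem_nhdsWithin.mono fun η hη => (jump_subst hf hw t₀ hη).symm

end Summit.RiemannHypothesis.RiemannHypothesis.Theorems.WeilCombBohrFejer

end
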